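import Summits.BirchSwinnertonDyer.BirchSwinnertonDyer.Theorems.ByReductionTypeAtTwoSupersingularFlatHondaLogTwist
import Summits.BirchSwinnertonDyer.BirchSwinnertonDyer.Theorems.ThetaPartnerAtTwoSignedKatoUpToAtTwoPlusHondaLogPairingEnum
import HarnessLib

/-!
# Crux `SupersingularRankZeroAtTwo` (K4, item stmt-BirchSwinnertonDyer-19097), line `odd_blind_package` v2.19, `stub_flatPackage`
# conjunct (8), F3 — FILE E1: the LOG CHARACTER SUM OF THE SPRUNG–HONDA POINT at `2`, `∑_a ψ(a)·Λ(T⁻¹(τ_a • d_n)) = N(1+ψ(−1))·τ(ψ)`,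
# and its `⟨5⟩`-enumeration `∑_{j<2ⁿ} χ(5)ʲ·Λ(T⁻¹(g₀ʲ • d_n)) = N·τ(χ)` (= FILE E2's `hlogprim` with `u = N` for THE system of FILE E0)

Seat `bsd-2adic-tower-1` GEN 69, hand «hF3-ERL» (pen GEN 41 SUMMON 20260831T215831Z, director-bsd (979) slot 2). HONEST FRAMING:
theorems only (no definition, no named fact, no instance, no `sorry`); local Galois bookkeeping at `2` on the displayed data of
`SSHondaTwo.sprungPrimal_padic_withLog`; helper toward conjunct (8) F3 of `stub_flatPackage`; closes no stub and no item; 19097 OPEN; BSD₂ is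
proved for no supersingular curve and BSD for no curve by any of this.

## What (displayed data: tower points `y_m` with `T⁻¹ y_m ∈ L(m) ∩ E₁`, `Λ(T⁻¹ y_m) = ℓ_m(x) = ∑_{k<m} x_k(ζ_{2^{m−k}} − 1)`, `x 0 = 1`,
## stabilisers `Stab(ζ_{2^m}) • y_m = y_m`, inverters `σ_m ζ_{2^m} = ζ_{2^m}⁻¹`, `d_n = N•(y_{n+2} + σ_{n+2}•y_{n+2}) − 2•y_1`)

* §1 `smul_flatPoint_eq`, `smul_flatPoint_eq_of_smul_zeta_eq`, `smul_flatPoint_eq_of_smul_zeta_eq_inv` — `ρ • d_n` depends only on `ρ ζ_{2^{n+2}}`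
  up to inversion (K3 `LocalVar.smul_plusPoint_eq*` with `3 ↦ N`);
* §2 ★ `sum_mul_ptLogΩ_smul_flatHondaPoint_eq` — for every `n`, every family `τ_a ∈ Γ_{ℚ₂}` with `τ_a ζ_{2^{n+2}} = ζ_{2^{n+2}}^a` on units and every
  PRIMITIVE `ψ` mod `2^{n+2}`: `∑_a ψ(a)·Λ(T⁻¹(τ_a • d_n)) = N·(1 + ψ(−1))·τ(ψ, ζ_{2^{n+2}})` (FILE E1a on the transported action);
  ★★ `sum_pow_mul_ptLogΩ_pow_smul_flatHondaPoint_eq` — for `g₀ ζ_{2^{n+2}} = ζ_{2^{n+2}}^5` and every EVEN PRIMITIVE `χ`: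
  `∑_{j<2ⁿ} χ(5)ʲ·Λ(T⁻¹(g₀ʲ • d_n)) = N·τ(χ)` — with `L j := Λ(T⁻¹(g₀ʲ • d_n))` this is `SSFlatERL.flat_level_identity_primitive`'s `hlogprim` with
  `u = N = 3 − a₂`; K3's `LocalVar.sum_pow_mul_ptLogΩ_pow_smul_plusHondaPoint_eq` is `N = 3`.

References: [Kobayashi2003] S. Kobayashi, Invent. Math. 152 (2003), §8.4 (Lemma 8.9), Prop. 8.25–8.26 (pp. 24–25), (8.23); [Sprung2012] F. Sprung,
J. Number Theory 132 (2012), Thm. 2.2, Lemma 2.3; [MazurTateTeitelbaum1986Invent] §I.13 (`ℤ₂ˣ = ±5^{ℤ₂}`); [Washington1997] Ch. 2 Thm. 2.5, §7.2.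
-/

set_option autoImplicit false
-- the Theorems namespace of this sub repeats the summit name by design (D-0017 nested layout)
set_option linter.dupNamespace false

noncomputable section

open scoped Classical IntermediateField Topology NNReal NumberField

namespace Summit.BirchSwinnertonDyer.BirchSwinnertonDyer.Theorems.SSFlatERL

open Field WeierstrassCurve NumberField IsDedekindDomain Literature.NumberTheory.EllipticCurves
  Literature.NumberTheory.GaloisRepresentations
  Literature.NumberTheory.EllipticCurves.ZpExtension Literature.NumberTheory.EllipticCurves.Kobayashi2003
  Literature.NumberTheory.EllipticCurves.FormalGroupChart Literature.NumberTheory.EllipticCurves.Rank1Residual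
  Summit.BirchSwinnertonDyer.Rank1Residual.Additive Summit.BirchSwinnertonDyer.Rank1Residual.Additive.PadicCyclotomicTower
  Summit.BirchSwinnertonDyer.Rank1Residual.Additive.BallEval
  Summit.BirchSwinnertonDyer.BirchSwinnertonDyer.Theorems.SignedKatoOffTwo.LocalTwo
  Summit.BirchSwinnertonDyer.BirchSwinnertonDyer.Theorems.SignedKatoOffTwo.HondaLog
  Summit.BirchSwinnertonDyer.BirchSwinnertonDyer.Theorems.SignedKatoOffTwo.LocalVar
  Summit.BirchSwinnertonDyer.BirchSwinnertonDyer.Theorems.SignedKatoOffTwo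
  Summit.BirchSwinnertonDyer.BirchSwinnertonDyer.Theorems.SignedEC.PlusLayer

/-! ## §1 The Galois orbit of the Sprung–Honda point factors through the action on `ζ_{2^{n+2}}`, up to inversion -/

section Orbit

variable {W : WeierstrassCurve ℚ} {y : ℕ → localPoints W ℚ_[2]} {σ : ℕ → Field.absoluteGaloisGroup ℚ_[2]}
  {d : ℕ → localPoints W ℚ_[2]} {N : ℕ}

/-- The action of `ρ` on the displayed Sprung–Honda point: `ρ • d_n = N•(ρ•y_{n+2} + (ρσ_{n+2})•y_{n+2}) − 2•y_1`. [cite: Kobayashi2003, §8.4] -/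
theorem smul_flatPoint_eq (hystab : ∀ m, ∀ τ ∈ stab 2 m, τ • y m = y m)
    (hd : ∀ n, d n = N • (y (n + 2) + σ (n + 2) • y (n + 2)) - 2 • y 1) (n : ℕ) (ρ : Field.absoluteGaloisGroup ℚ_[2]) :
    ρ • d n = N • (ρ • y (n + 2) + (ρ * σ (n + 2)) • y (n + 2)) - 2 • y 1 := by
  rw [hd n, smul_sub, smul_comm ρ N, smul_comm ρ (2 : ℕ), smul_add, mul_smul, smul_towerPoint_one hystab ρ]

/-- **`ρ • d_n` depends only on `ρ ζ_{2^{n+2}}`**: `ρ ζ = ρ' ζ ⇒ ρ • d_n = ρ' • d_n`. [cite: Kobayashi2003, §8.4, Prop. 8.26] -/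
theorem smul_flatPoint_eq_of_smul_zeta_eq (hystab : ∀ m, ∀ τ ∈ stab 2 m, τ • y m = y m)
    (hσ : ∀ m, 1 ≤ m → σ m • zeta 2 m = (zeta 2 m)⁻¹)
    (hd : ∀ n, d n = N • (y (n + 2) + σ (n + 2) • y (n + 2)) - 2 • y 1) (n : ℕ)
    {ρ ρ' : Field.absoluteGaloisGroup ℚ_[2]} (h : ρ • zeta 2 (n + 2) = ρ' • zeta 2 (n + 2)) :
    ρ • d n = ρ' • d n := by
  have h' : (ρ * σ (n + 2)) • zeta 2 (n + 2) = (ρ' * σ (n + 2)) • zeta 2 (n + 2) := by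
    rw [mul_smul, mul_smul, hσ (n + 2) (by omega), smul_inv'', smul_inv'', h]
  rw [smul_flatPoint_eq hystab hd n ρ, smul_flatPoint_eq hystab hd n ρ', smul_towerPoint_eq_of_smul_zeta_eq hystab h,
    smul_towerPoint_eq_of_smul_zeta_eq hystab h']

/-- **… and only up to inversion**: `ρ ζ = (ρ' ζ)⁻¹ ⇒ ρ • d_n = ρ' • d_n`. [cite: Kobayashi2003, §8.4, Prop. 8.26] -/
theorem smul_flatPoint_eq_of_smul_zeta_eq_inv (hystab : ∀ m, ∀ τ ∈ stab 2 m, τ • y m = y m)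
    (hσ : ∀ m, 1 ≤ m → σ m • zeta 2 m = (zeta 2 m)⁻¹)
    (hd : ∀ n, d n = N • (y (n + 2) + σ (n + 2) • y (n + 2)) - 2 • y 1) (n : ℕ)
    {ρ ρ' : Field.absoluteGaloisGroup ℚ_[2]} (h : ρ • zeta 2 (n + 2) = (ρ' • zeta 2 (n + 2))⁻¹) :
    ρ • d n = ρ' • d n := by
  have h1 : ρ • zeta 2 (n + 2) = (ρ' * σ (n + 2)) • zeta 2 (n + 2) := by
    rw [mul_smul, hσ (n + 2) (by omega), smul_inv'', h]
  have h2 : (ρ * σ (n + 2)) • zeta 2 (n + 2) = ρ' • zeta 2 (n + 2) := by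
    rw [mul_smul, hσ (n + 2) (by omega), smul_inv'', h, inv_inv]
  rw [smul_flatPoint_eq hystab hd n ρ, smul_flatPoint_eq hystab hd n ρ', smul_towerPoint_eq_of_smul_zeta_eq hystab h1,
    smul_towerPoint_eq_of_smul_zeta_eq hystab h2, add_comm]

end Orbit

/-! ## §2 The log character sums of the Sprung–Honda point -/

section CharSum

open Rat.HeightOneSpectrum

/-- **Kobayashi Prop. 8.26 at `2` for the displayed Sprung–Honda point.** For `W/ℚ` globally minimal, the displayed data
(`T⁻¹ y_m ∈ L(m) ∩ E₁`, `Λ(T⁻¹ y_m) = ℓ_m(x)`, `x 0 = 1`, inverters `σ_m`, `d_n = N•(y_{n+2} + σ_{n+2}•y_{n+2}) − 2•y_1`), every `n`, every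
`τ : ℤ/2^{n+2} → Γ_{ℚ₂}` with `τ_a ζ_{2^{n+2}} = ζ_{2^{n+2}}^a` on units and every primitive `ψ` mod `2^{n+2}`:
`∑_a ψ(a) · Λ(T⁻¹(τ_a • d_n)) = N(1 + ψ(−1)) · τ(ψ, ζ_{2^{n+2}})`. K3's `PlusLayer.sum_mul_ptLogΩ_smul_plusHondaPoint_eq` is `N = 3`, Kobayashi's `x`.
[cite: Kobayashi2003, Prop. 8.26 (p. 25)] [cite: Sprung2012, Lemma 2.3] -/
theorem sum_mul_ptLogΩ_smul_flatHondaPoint_eq (W : WeierstrassCurve ℚ) [W.IsElliptic] [W.IsGloballyMinimal]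
    {x : ℕ → ℚ_[2]} (hx0 : x 0 = 1)
    {y : ℕ → localPoints W ℚ_[2]} {σ : ℕ → Field.absoluteGaloisGroup ℚ_[2]} {d : ℕ → localPoints W ℚ_[2]} {N : ℕ}
    (hyΩ : haveI := isIntegral_genFib_baseChange 2 ((integralModelInt W).map (Int.castRingHom ℤ_[2]))
        ∀ m, (toLoc ((genFibΩ_eq_baseChange ((integralModelInt W).map (Int.castRingHom ℤ_[2]))).trans
              (baseChange_twoAdicModel W))).symm (y m) ∈
            subfieldPoints (genFibΩ 2 ((integralModelInt W).map (Int.castRingHom ℤ_[2]))) (layer 2 m).toSubfield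
              coeffs_mem_layer ∧
          (toLoc ((genFibΩ_eq_baseChange ((integralModelInt W).map (Int.castRingHom ℤ_[2]))).trans
              (baseChange_twoAdicModel W))).symm (y m) ∈
            kernel (Valued.v (R := PadicAlgCl 2)) (genFibΩ 2 ((integralModelInt W).map (Int.castRingHom ℤ_[2]))) ∧
          ptLogΩ 2 ((integralModelInt W).map (Int.castRingHom ℤ_[2]))
            ((toLoc ((genFibΩ_eq_baseChange ((integralModelInt W).map (Int.castRingHom ℤ_[2]))).trans
              (baseChange_twoAdicModel W))).symm (y m)) =
            ∑ k ∈ Finset.range m, algebraMap ℚ_[2] (PadicAlgCl 2) (x k) * (zeta 2 (m - k) - 1))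
    (hσ : ∀ m, 1 ≤ m → σ m • zeta 2 m = (zeta 2 m)⁻¹)
    (hd : ∀ n, d n = N • (y (n + 2) + σ (n + 2) • y (n + 2)) - 2 • y 1)
    (n : ℕ) [NeZero (2 ^ (n + 2))] (τ : ZMod (2 ^ (n + 2)) → Field.absoluteGaloisGroup ℚ_[2])
    (hτ : ∀ a : ZMod (2 ^ (n + 2)), IsUnit a → τ a • zeta 2 (n + 2) = zeta 2 (n + 2) ^ a.val)
    (ψ : DirichletCharacter (PadicAlgCl 2) (2 ^ (n + 2))) (hψ : ψ.IsPrimitive) :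
    haveI := isIntegral_genFib_baseChange 2 ((integralModelInt W).map (Int.castRingHom ℤ_[2]))
    ∑ a : ZMod (2 ^ (n + 2)), ψ a *
        ptLogΩ 2 ((integralModelInt W).map (Int.castRingHom ℤ_[2]))
          ((toLoc ((genFibΩ_eq_baseChange ((integralModelInt W).map (Int.castRingHom ℤ_[2]))).trans
            (baseChange_twoAdicModel W))).symm (τ a • d n)) =
      (N : PadicAlgCl 2) * (1 + ψ (-1)) * gaussSum ψ (AddChar.zmodChar (2 ^ (n + 2)) (zeta_pow_prime_pow_self (p := 2) (n + 2))) := by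
  set M : WeierstrassCurve ℤ_[2] := (integralModelInt W).map (Int.castRingHom ℤ_[2]) with hM
  haveI := isElliptic_coe_twoAdicModel W
  haveI hintΩ := isIntegral_genFib_baseChange 2 M
  set hV := (genFibΩ_eq_baseChange M).trans (baseChange_twoAdicModel W) with hVdef
  set act : Field.absoluteGaloisGroup ℚ_[2] → (genFibΩ 2 M).toAffine.Point → (genFibΩ 2 M).toAffine.Point :=
    fun ρ P ↦ (toLoc hV).symm (ρ • toLoc hV P) with hact
  obtain ⟨hcL, hck, hcℓ⟩ := hyΩ (n + 2)
  obtain ⟨hc₁L, hc₁k, hc₁ℓ⟩ := hyΩ 1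
  -- the transported point is `act (τ a) (N•(C + act σ C) − 2•C₁)`
  have hD : (toLoc hV).symm (d n) =
      N • ((toLoc hV).symm (y (n + 2)) + act (σ (n + 2)) ((toLoc hV).symm (y (n + 2)))) -
        (2 : ℕ) • (toLoc hV).symm (y 1) := by
    rw [hd n, map_sub, map_nsmul, map_nsmul, map_add, hact]
    simp only [AddEquiv.apply_symm_apply]
  have hpt : ∀ a : ZMod (2 ^ (n + 2)), (toLoc hV).symm (τ a • d n) =
      act (τ a) (N • ((toLoc hV).symm (y (n + 2)) + act (σ (n + 2)) ((toLoc hV).symm (y (n + 2)))) -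
        (2 : ℕ) • (toLoc hV).symm (y 1)) := by
    intro a
    rw [← hD, hact]
    simp only [AddEquiv.apply_symm_apply]
  simp only [hpt]
  rw [sum_mul_ptLogΩ_act_flatPoint_eq x N act (act_zero hV) (act_some hV) (by omega : 2 ≤ n + 2) (hσ (n + 2) (by omega)) τ hτ
    hcL hck hcℓ hc₁L hc₁k hc₁ℓ ψ hψ, hx0, map_one, mul_one]

/-- **Kobayashi Prop. 8.26 at `2` in the `gʲ`-enumeration, for the Sprung–Honda point** — FILE E2's `hlogprim` with `u = N`: for the displayed
data (plus the stabiliser clause `Stab(ζ_{2^m}) • y_m = y_m`), every `n`, every `g₀ ∈ Γ_{ℚ₂}` with `g₀ ζ_{2^{n+2}} = ζ_{2^{n+2}}^5` and every EVEN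
PRIMITIVE Dirichlet character `χ` modulo `2^{n+2}` (values in `ℚ̄₂`): `∑_{j<2ⁿ} χ(5)ʲ · Λ(T⁻¹(g₀ʲ • d_n)) = N · ∑_a χ(a) ζ_{2^{n+2}}^a`
(re-indexing `∑_a` by the units `±5ˢ`, `τ_{±5ˢ} • d_n = g₀ˢ • d_n` by §1). K3's `LocalVar.sum_pow_mul_ptLogΩ_pow_smul_plusHondaPoint_eq` is `N = 3`.
[cite: Kobayashi2003, Prop. 8.26 (p. 25), (8.23)] [cite: MazurTateTeitelbaum1986Invent, §I.13] [cite: Sprung2012, Lemma 2.3] -/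
theorem sum_pow_mul_ptLogΩ_pow_smul_flatHondaPoint_eq (W : WeierstrassCurve ℚ) [W.IsElliptic] [W.IsGloballyMinimal]
    {x : ℕ → ℚ_[2]} (hx0 : x 0 = 1)
    {y : ℕ → localPoints W ℚ_[2]} {σ : ℕ → Field.absoluteGaloisGroup ℚ_[2]} {d : ℕ → localPoints W ℚ_[2]} {N : ℕ}
    (hyΩ : haveI := isIntegral_genFib_baseChange 2 ((integralModelInt W).map (Int.castRingHom ℤ_[2]))
        ∀ m, (toLoc ((genFibΩ_eq_baseChange ((integralModelInt W).map (Int.castRingHom ℤ_[2]))).trans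
              (baseChange_twoAdicModel W))).symm (y m) ∈
            subfieldPoints (genFibΩ 2 ((integralModelInt W).map (Int.castRingHom ℤ_[2]))) (layer 2 m).toSubfield
              coeffs_mem_layer ∧
          (toLoc ((genFibΩ_eq_baseChange ((integralModelInt W).map (Int.castRingHom ℤ_[2]))).trans
              (baseChange_twoAdicModel W))).symm (y m) ∈
            kernel (Valued.v (R := PadicAlgCl 2)) (genFibΩ 2 ((integralModelInt W).map (Int.castRingHom ℤ_[2]))) ∧
          ptLogΩ 2 ((integralModelInt W).map (Int.castRingHom ℤ_[2]))
            ((toLoc ((genFibΩ_eq_baseChange ((integralModelInt W).map (Int.castRingHom ℤ_[2]))).trans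
              (baseChange_twoAdicModel W))).symm (y m)) =
            ∑ k ∈ Finset.range m, algebraMap ℚ_[2] (PadicAlgCl 2) (x k) * (zeta 2 (m - k) - 1))
    (hystab : ∀ m, ∀ τ ∈ stab 2 m, τ • y m = y m)
    (hσ : ∀ m, 1 ≤ m → σ m • zeta 2 m = (zeta 2 m)⁻¹)
    (hd : ∀ n, d n = N • (y (n + 2) + σ (n + 2) • y (n + 2)) - 2 • y 1)
    (n : ℕ) [NeZero (2 ^ (n + 2))] {g₀ : Field.absoluteGaloisGroup ℚ_[2]}
    (hg₀ : g₀ • zeta 2 (n + 2) = zeta 2 (n + 2) ^ 5)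
    (χ : DirichletCharacter (PadicAlgCl 2) (2 ^ (n + 2))) (hχ : χ.IsPrimitive) (hev : χ (-1) = 1) :
    haveI := isIntegral_genFib_baseChange 2 ((integralModelInt W).map (Int.castRingHom ℤ_[2]))
    ∑ j ∈ Finset.range (2 ^ n), χ (5 : ZMod (2 ^ (n + 2))) ^ j *
        ptLogΩ 2 ((integralModelInt W).map (Int.castRingHom ℤ_[2]))
          ((toLoc ((genFibΩ_eq_baseChange ((integralModelInt W).map (Int.castRingHom ℤ_[2]))).trans
            (baseChange_twoAdicModel W))).symm (g₀ ^ j • d n)) =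
      (N : PadicAlgCl 2) * gaussSum χ (AddChar.zmodChar (2 ^ (n + 2)) (zeta_pow_prime_pow_self (p := 2) (n + 2))) := by
  haveI hintΩ := isIntegral_genFib_baseChange 2 ((integralModelInt W).map (Int.castRingHom ℤ_[2]))
  set Λ : localPoints W ℚ_[2] → PadicAlgCl 2 := fun P ↦
    ptLogΩ 2 ((integralModelInt W).map (Int.castRingHom ℤ_[2]))
      ((toLoc ((genFibΩ_eq_baseChange ((integralModelInt W).map (Int.castRingHom ℤ_[2]))).trans
        (baseChange_twoAdicModel W))).symm P) with hΛ
  -- a Galois family `τ_a` with `τ_a ζ = ζ^a` on units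
  have hex : ∀ a : ZMod (2 ^ (n + 2)), IsUnit a →
      ∃ ρ : Field.absoluteGaloisGroup ℚ_[2], ρ • zeta 2 (n + 2) = zeta 2 (n + 2) ^ a.val :=
    fun a ha ↦ exists_smul_zeta_eq_pow_of_isUnit (n + 2) ha
  choose! τ hτ using hex
  -- §2 for this family, re-indexed by the units `±5^s`
  have hR3 := sum_mul_ptLogΩ_smul_flatHondaPoint_eq W hx0 hyΩ hσ hd n τ hτ χ hχ
  rw [hev, HondaLogChi.sum_mulChar_eq_sum_pow_five_of_even n χ hev] at hR3
  -- powers of `g₀` on `ζ`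
  have hζN : zeta 2 (n + 2) ^ 2 ^ (n + 2) = 1 := zeta_pow_prime_pow_self (p := 2) (n + 2)
  have hg₀j : ∀ j : ℕ, g₀ ^ j • zeta 2 (n + 2) = zeta 2 (n + 2) ^ 5 ^ j := by
    intro j
    induction j with
    | zero => rw [pow_zero, one_smul, pow_zero, pow_one]
    | succ j ih => rw [pow_succ', mul_smul, ih, smul_pow', hg₀, ← pow_mul, ← pow_succ']
  have h5u : ∀ s : ℕ, IsUnit ((5 : ZMod (2 ^ (n + 2))) ^ s) := by
    intro s
    have h5 : IsUnit (5 : ZMod (2 ^ (n + 2))) := by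
      have h := (ZMod.isUnit_iff_coprime 5 (2 ^ (n + 2))).mpr (Nat.Coprime.pow_right _ (by norm_num))
      exact_mod_cast h
    exact h5.pow s
  have hval : ∀ s : ℕ, zeta 2 (n + 2) ^ ((5 : ZMod (2 ^ (n + 2))) ^ s).val = zeta 2 (n + 2) ^ 5 ^ s := by
    intro s
    have h5 : (5 : ZMod (2 ^ (n + 2))) ^ s = ((5 ^ s : ℕ) : ZMod (2 ^ (n + 2))) := by push_cast; rfl
    rw [h5, ZMod.val_natCast, ← pow_eq_pow_mod _ hζN]
  have hplus : ∀ s : ℕ, τ ((5 : ZMod (2 ^ (n + 2))) ^ s) • d n = g₀ ^ s • d n := by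
    intro s
    refine smul_flatPoint_eq_of_smul_zeta_eq hystab hσ hd n ?_
    rw [hτ _ (h5u s), hval, hg₀j]
  have hminus : ∀ s : ℕ, τ (-(5 : ZMod (2 ^ (n + 2))) ^ s) • d n = g₀ ^ s • d n := by
    intro s
    refine smul_flatPoint_eq_of_smul_zeta_eq_inv hystab hσ hd n ?_
    rw [hτ _ ((h5u s).neg), pow_neg_val_eq_inv hζN, hval, hg₀j]
  -- assemble
  have hsum : ∑ s : ZMod (2 ^ n), χ ((5 : ZMod (2 ^ (n + 2))) ^ s.val) *
      (Λ (τ ((5 : ZMod (2 ^ (n + 2))) ^ s.val) • d n) + Λ (τ (-(5 : ZMod (2 ^ (n + 2))) ^ s.val) • d n)) =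
      2 * ∑ j ∈ Finset.range (2 ^ n), χ (5 : ZMod (2 ^ (n + 2))) ^ j * Λ (g₀ ^ j • d n) := by
    rw [Finset.mul_sum, ← Summit.BirchSwinnertonDyer.Rank1Residual.F1Sign2.sum_zmod_val_eq_sum_range (2 ^ n)
      (fun j ↦ 2 * (χ (5 : ZMod (2 ^ (n + 2))) ^ j * Λ (g₀ ^ j • d n)))]
    refine Finset.sum_congr rfl fun s _ ↦ ?_
    rw [hplus, hminus, map_pow]
    ring
  have h2 : (2 : PadicAlgCl 2) ≠ 0 := two_ne_zero
  have key : 2 * ∑ j ∈ Finset.range (2 ^ n), χ (5 : ZMod (2 ^ (n + 2))) ^ j * Λ (g₀ ^ j • d n) =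
      2 * ((N : PadicAlgCl 2) * gaussSum χ (AddChar.zmodChar (2 ^ (n + 2)) (zeta_pow_prime_pow_self (p := 2) (n + 2)))) := by
    rw [← hsum, hR3]; ring
  exact mul_left_cancel₀ h2 key

end CharSum

end Summit.BirchSwinnertonDyer.BirchSwinnertonDyer.Theorems.SSFlatERL

end
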